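import Literature.NumberTheory.GaloisCohomology.Howard2004.FrobIdealProofs
import Literature.NumberTheory.GaloisCohomology.Howard2004.QuotFunctoriality
import Literature.NumberTheory.GaloisCohomology.Howard2004.DVRKolyvaginBound
import HarnessLib

/-!
# Howard 2004, Def. 1.1.3 / 1.1.8 / 1.2.1 at the quotients `T/IT` and the Kolyvagin levels `T/I_nT`

B. Howard, *The Heegner point Kolyvagin system*, Compos. Math. 140 (2004) (arXiv:1202.6340).
The tree records an object `T/IT` of `Quot(T)` (Def. 1.1.3) as a PRESENTATION
`IsQuotientBy ρ I ρI π` (`SelmerTriples.lean` §E: `π : T →ₗ[R] N` surjective, `ker π = I•T`,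
`Γ_K`-equivariant), the Kolyvagin quotients `T/I_nT` as `LevelData.isQuotientBy n`
(§G, `I_n = levelIdeal`), and `I_ℓ = frobIdeal` (§D; its defining property is
`FrobIdealProofs.lean`).  Howard's finite–singular comparison map
`φ^{fs}_ℓ : H¹_f(K_ℓ, T/I_{nℓ}T) ≅ H¹_s(K_ℓ, T/I_{nℓ}T) ⊗ G_ℓ` (display (ks relations), arXiv p. 6
L120–125) is the isomorphism of Prop. 1.1.7 / Def. 1.1.8, whose hypotheses read «If `v` does not
divide `p`, `G_{K_v}` acts trivially on `T`, and `|k_v^×|·T = 0`» (arXiv Prop. 2.1.7, p. 5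
L129–131) — to be discharged for the module `T/I_{nℓ}T` at `v = λ ∣ nℓ`, which is what
Def. 1.2.1 («`I_ℓ` the smallest ideal of `R` containing `ℓ+1` for which `Frob_λ` acts trivially on
`T/I_ℓT`», arXiv p. 6 L63–66; `I_n = Σ_{ℓ∣n} I_ℓ`, L73–75) is designed to give.

This file proves, sorry-free and in the presentation currency (no instance, no new definition):

§1 (any presentation `h : IsQuotientBy ρ I ρI π`; `I` kills `T/IT` and `R`-linearity descends are
`QuotFunctoriality.lean`'s `smul_eq_zero_of_mem` / `isTorsionBySet` / `isScalarLinear`, imported)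
* `smul_top_eq_bot` — `I • (T/IT) = 0`;
* `apply_eq_self_iff` (+ the two directions) — «`σ` acts trivially on `T/IT`» ↔
  `∀ m, ρ σ m - m ∈ I•T`, the reading used in the typed `frobIdeal`;
* `sub_mem_smul_top`, `map_eq_one`, `isUnramifiedAtPrime`, `isUnramifiedAt`,
  `degreeTwoPrimes_subset_degreeTwoPrimes`, `frobIdeal_le_frobIdeal`,
  `kolyvaginPrimes_subset_kolyvaginPrimes`, `levelIdeal_le_levelIdeal` — what `T/IT` inherits from
  `T` (congruences modulo `J•T`, trivial action, unramifiedness; hence `𝓛₀(T) ⊆ 𝓛₀(T/IT)`,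
  `I_ℓ(T/IT) ≤ I_ℓ(T)`, `𝓛_k(T) ⊆ 𝓛_k(T/IT)`, `I_n(T/IT) ≤ I_n(T)`);
* `comp` — `(T/IT)/J(T/IT)` presents `T/JT` for `I ≤ J` (quotients in stages).
§2 (a prime `v` with `I_ℓ ≤ I`)
* `natCast_residueChar_add_one_smul_eq_zero`, `residueChar_add_one_nsmul_eq_zero`,
  `residueChar_sq_sub_one_nsmul_eq_zero` — `(ℓ+1)·(T/IT) = 0`, hence `(ℓ²-1)·(T/IT) = 0`
  (`ℓ² - 1 = |k_λ^×|` at a degree-two `λ`), with NO hypothesis on `R` or `T`;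
* `frobIdeal_le_of_apply_eq_self` (always) and `apply_eq_self_of_isArithFrobAtPlace_of_mem`
  (+ `_of_free` = H.0, `_of_h0`, `_of_isDiscreteValuationRing`), `frobIdeal_le_iff_of_mem'` —
  Def. 1.2.1 verbatim on presentations: `Frob_λ` acts trivially on `T/IT` iff `I_ℓ ≤ I` (given
  `ℓ+1 ∈ I`), under the defining property of `I_ℓ`.
§3 (`D : LevelData R ρ t N`, `v ∈ n`) the same at the Kolyvagin levels `T/I_nT`:
  `LevelData.smul_eq_zero_of_mem_levelIdeal`, `LevelData.natCast_residueChar_add_one_smul_eq_zero`,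
  `LevelData.ρq_apply_eq_self_of_free` / `_of_h0`, `LevelData.isUnramifiedAt`,
  `LevelData.isUnramifiedAt_of_mem_primes`, `LevelData.isScalarLinear`.
§4 (`T : AdicTower K R N`) the compact-`T` prime sets of `DVRKolyvaginBound.lean` against the typed
  levelwise ones: `AdicTower.kolyvaginPrimes_antitone`, `AdicTower.mem_kolyvaginPrimes_level`
  (`𝓛_s(T) ⊆ 𝓛_s(T^{(k)})` for every level, typed over `R`), `AdicTower.mem_kolyvaginPrimes_iff`
  (equality with `⋂_k` for `R` a DVR with `ℓ+1 ≠ 0`).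

## Main statements

* `IsQuotientBy.apply_eq_self_iff`, `IsQuotientBy.natCast_residueChar_add_one_smul_eq_zero`,
  `IsQuotientBy.apply_eq_self_of_isArithFrobAtPlace_of_free`, `LevelData.ρq_apply_eq_self_of_h0`.
-/

set_option autoImplicit false

open Function NumberField IsDedekindDomain Field
open scoped NumberField ContRepresentation Classical

namespace Literature.NumberTheory.GaloisCohomology.Howard2004

open Literature.NumberTheory.GaloisRepresentations
open Literature.NumberTheory.GaloisRepresentations.DiscreteGaloisModule

/-! ## 1. What `T/IT` inherits from `T` -/

section Quot

variable {K : Type} [Field K] [NumberField K] {M : Type} [AddCommGroup M] [TopologicalSpace M]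
  [DiscreteTopology M] {R : Type} [CommRing R] [Module R M]
  {N : Type} [AddCommGroup N] [TopologicalSpace N] [DiscreteTopology N] [Module R N]
  {N' : Type} [AddCommGroup N'] [TopologicalSpace N'] [DiscreteTopology N'] [Module R N']

namespace IsQuotientBy

variable {ρ : DiscreteGaloisModule K M} {I : Ideal R} {ρI : DiscreteGaloisModule K N}
  {π : M →ₗ[R] N}

omit [NumberField K] in
/-- `I • (T/IT) = 0`. [cite: Howard2004HeegnerKolyvagin, Def. 1.1.3 (arXiv Def. 2.1.3, p. 5, L93–99)] -/
theorem smul_top_eq_bot (h : IsQuotientBy ρ I ρI π) :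
    (I • (⊤ : Submodule R N) : Submodule R N) = ⊥ := by
  refine (Submodule.smul_le.mpr fun r hr x _ => ?_).antisymm bot_le
  rw [h.smul_eq_zero_of_mem hr x]
  exact Submodule.zero_mem _

omit [NumberField K] in
/-- A congruence `ρ σ m ≡ m (mod J•T)` on `T` descends to `T/IT`: `ρ_I σ x ≡ x (mod J•(T/IT))`.
[cite: Howard2004HeegnerKolyvagin, Def. 1.1.3 (arXiv Def. 2.1.3, p. 5, L93–99)] -/
theorem sub_mem_smul_top (h : IsQuotientBy ρ I ρI π) {J : Ideal R} {σ : absoluteGaloisGroup K}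
    (hσ : ∀ m : M, ρ σ m - m ∈ (J • (⊤ : Submodule R M) : Submodule R M)) (x : N) :
    ρI σ x - x ∈ (J • (⊤ : Submodule R N) : Submodule R N) := by
  obtain ⟨m, rfl⟩ := h.surjective x
  rw [← h.equivariant, ← map_sub]
  have hmap : Submodule.map π (J • (⊤ : Submodule R M)) ≤ J • (⊤ : Submodule R N) := by
    rw [Submodule.map_smul'']
    exact smul_mono_right J le_top
  exact hmap (Submodule.mem_map_of_mem (hσ m))

omit [NumberField K] in
/-- If `ρ σ m ≡ m (mod I•T)` for all `m`, then `σ` acts trivially on `T/IT`.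
[cite: Howard2004HeegnerKolyvagin, Def. 1.1.3 and Def. 1.2.1 (arXiv p. 5 L93–99, p. 6 L63–66)] -/
theorem apply_eq_self_of_forall_sub_mem (h : IsQuotientBy ρ I ρI π) {σ : absoluteGaloisGroup K}
    (hσ : ∀ m : M, ρ σ m - m ∈ (I • (⊤ : Submodule R M) : Submodule R M)) (x : N) :
    ρI σ x = x := by
  obtain ⟨m, rfl⟩ := h.surjective x
  rw [← h.equivariant, ← sub_eq_zero, ← map_sub, ← LinearMap.mem_ker, h.ker_eq]
  exact hσ m

omit [NumberField K] in
/-- Conversely, if `σ` acts trivially on `T/IT` then `ρ σ m ≡ m (mod I•T)` for all `m ∈ T`.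
[cite: Howard2004HeegnerKolyvagin, Def. 1.1.3 and Def. 1.2.1 (arXiv p. 5 L93–99, p. 6 L63–66)] -/
theorem sub_mem_of_apply_eq_self (h : IsQuotientBy ρ I ρI π) {σ : absoluteGaloisGroup K}
    (hσ : ∀ x : N, ρI σ x = x) (m : M) :
    ρ σ m - m ∈ (I • (⊤ : Submodule R M) : Submodule R M) := by
  rw [← h.ker_eq, LinearMap.mem_ker, map_sub, h.equivariant, hσ, sub_self]

omit [NumberField K] in
/-- **«`σ` acts trivially on `T/IT`»** in the presentation currency: `ρ_I σ = id` on `N` iff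
`ρ σ m - m ∈ I•T` for every `m` (the reading used by the typed `I_ℓ = frobIdeal`).
[cite: Howard2004HeegnerKolyvagin, Def. 1.2.1 (arXiv Def. 2.2.1, p. 6, L63–66)] -/
theorem apply_eq_self_iff (h : IsQuotientBy ρ I ρI π) (σ : absoluteGaloisGroup K) :
    (∀ x : N, ρI σ x = x) ↔ ∀ m : M, ρ σ m - m ∈ (I • (⊤ : Submodule R M) : Submodule R M) :=
  ⟨fun hσ m => h.sub_mem_of_apply_eq_self hσ m, fun hσ x => h.apply_eq_self_of_forall_sub_mem hσ x⟩

omit [NumberField K] in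
/-- An element acting trivially on `T` acts trivially on `T/IT`.
[cite: Howard2004HeegnerKolyvagin, Def. 1.1.3 (arXiv Def. 2.1.3, p. 5, L93–99)] -/
theorem map_eq_one (h : IsQuotientBy ρ I ρI π) {σ : absoluteGaloisGroup K} (hσ : ρ σ = 1) :
    ρI σ = 1 := by
  ext x
  obtain ⟨m, rfl⟩ := h.surjective x
  rw [← h.equivariant, hσ, Module.End.one_apply, Module.End.one_apply]

omit [NumberField K] in
/-- `T` unramified at a prime `𝔓` of `K̄` ⇒ `T/IT` unramified at `𝔓`.
[cite: Howard2004HeegnerKolyvagin, §1.2 (arXiv p. 6, L54–56) with Def. 1.1.3] -/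
theorem isUnramifiedAtPrime (h : IsQuotientBy ρ I ρI π) {𝔓 : Ideal (absIntegers (𝓞 K) K)}
    (hur : GaloisRep.IsUnramifiedAtPrime 𝔓 ρ) : GaloisRep.IsUnramifiedAtPrime 𝔓 ρI :=
  fun σ hσ => h.map_eq_one (hur σ hσ)

omit [NumberField K] in
/-- `T` unramified at the finite place `v` ⇒ `T/IT` unramified at `v` (so the primes at which
`T/IT` ramifies are among those at which `T` does).
[cite: Howard2004HeegnerKolyvagin, §1.2 (arXiv p. 6, L54–56) with Def. 1.1.3] -/
theorem isUnramifiedAt (h : IsQuotientBy ρ I ρI π) {v : HeightOneSpectrum (𝓞 K)}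
    (hur : GaloisRep.IsUnramifiedAt v ρ) : GaloisRep.IsUnramifiedAt v ρI :=
  fun 𝔓 h𝔓 => h.isUnramifiedAtPrime (hur 𝔓 h𝔓)

omit [NumberField K] in
/-- **`𝓛₀(T) ⊆ 𝓛₀(T/IT)`**: a degree-two prime not dividing `p` at which `T` is unramified is one
at which `T/IT` is unramified. [cite: Howard2004HeegnerKolyvagin, §1.2 (arXiv p. 6, L54–56)] -/
theorem degreeTwoPrimes_subset_degreeTwoPrimes (h : IsQuotientBy ρ I ρI π) (p : ℕ) :
    degreeTwoPrimes p ρ ⊆ degreeTwoPrimes p ρI :=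
  fun _ hv => ⟨hv.1, hv.2.1, h.isUnramifiedAt hv.2.2⟩

/-- **`I_ℓ(T/IT) ≤ I_ℓ(T)`**: every ideal `J ∋ ℓ+1` modulo which `Frob_λ` acts trivially on `T`
is one modulo which it acts trivially on `T/IT`.
[cite: Howard2004HeegnerKolyvagin, Def. 1.2.1 (arXiv Def. 2.2.1, p. 6, L63–66)] -/
theorem frobIdeal_le_frobIdeal (h : IsQuotientBy ρ I ρI π) (v : HeightOneSpectrum (𝓞 K)) :
    frobIdeal (R := R) ρI v ≤ frobIdeal (R := R) ρ v := by
  unfold frobIdeal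
  exact sInf_le_sInf fun J hJ => ⟨hJ.1, fun σ hσ x => h.sub_mem_smul_top (hJ.2 σ hσ) x⟩

/-- **`𝓛_k(T) ⊆ 𝓛_k(T/IT)`** (typed `kolyvaginPrimes`).
[cite: Howard2004HeegnerKolyvagin, Def. 1.2.1 (arXiv Def. 2.2.1, p. 6, L67–68)] -/
theorem kolyvaginPrimes_subset_kolyvaginPrimes (h : IsQuotientBy ρ I ρI π) (p k : ℕ) :
    kolyvaginPrimes (R := R) p ρ k ⊆ kolyvaginPrimes (R := R) p ρI k :=
  fun v hv => ⟨h.degreeTwoPrimes_subset_degreeTwoPrimes p hv.1, (h.frobIdeal_le_frobIdeal v).trans hv.2⟩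

/-- **`I_n(T/IT) ≤ I_n(T)`** (typed `levelIdeal`).
[cite: Howard2004HeegnerKolyvagin, Def. 1.2.1 (arXiv Def. 2.2.1, p. 6, L73–75)] -/
theorem levelIdeal_le_levelIdeal (h : IsQuotientBy ρ I ρI π)
    (n : Finset (HeightOneSpectrum (𝓞 K))) :
    levelIdeal (R := R) ρI n ≤ levelIdeal (R := R) ρ n := by
  unfold levelIdeal
  exact iSup₂_mono fun v _ => h.frobIdeal_le_frobIdeal v

omit [NumberField K] in
/-- **Quotients in stages**: if `N` presents `T/IT`, `I ≤ J`, and `N'` presents `N/JN`, then `N'`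
presents `T/JT` via the composite surjection (the objects `T/I_nT → T/I_{nℓ}T` of `Quot(T)`).
[cite: Howard2004HeegnerKolyvagin, Def. 1.1.3 (arXiv Def. 2.1.3, p. 5, L93–99)] -/
theorem comp (hI : IsQuotientBy ρ I ρI π) {J : Ideal R} (hIJ : I ≤ J)
    {ρJ : DiscreteGaloisModule K N'} {π' : N →ₗ[R] N'} (hJ : IsQuotientBy ρI J ρJ π') :
    IsQuotientBy ρ J ρJ (π'.comp π) where
  surjective := hJ.surjective.comp hI.surjective
  ker_eq := by
    have hmap : Submodule.map π (J • (⊤ : Submodule R M)) = J • (⊤ : Submodule R N) := by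
      rw [Submodule.map_smul'', Submodule.map_top, LinearMap.range_eq_top.mpr hI.surjective]
    rw [LinearMap.ker_comp, hJ.ker_eq, ← hmap, Submodule.comap_map_eq, hI.ker_eq]
    exact sup_eq_left.mpr (Submodule.smul_mono_left hIJ)
  equivariant σ m := by
    rw [LinearMap.comp_apply, LinearMap.comp_apply, hI.equivariant, hJ.equivariant]

/-! ## 2. At a prime `λ` with `I_ℓ ≤ I`: `(ℓ+1)·(T/IT) = 0` and `Frob_λ` acts trivially -/

omit [NumberField K] in
/-- An ideal `I ∋ ℓ+1` kills `(ℓ+1)·x` on `T/IT`. [cite: Howard2004HeegnerKolyvagin, Def. 1.2.1 (arXiv p. 6, L63–66)] -/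
theorem natCast_smul_eq_zero_of_mem (h : IsQuotientBy ρ I ρI π) {a : ℕ} (ha : ((a : ℕ) : R) ∈ I)
    (x : N) : (a : R) • x = 0 :=
  h.smul_eq_zero_of_mem ha x

/-- **`(ℓ+1)·(T/IT) = 0` whenever `I_ℓ ≤ I`** (e.g. `I = I_n`, `ℓ ∣ n`) — no hypothesis on `R`
or `T`, since `ℓ+1 ∈ I_ℓ` always. [cite: Howard2004HeegnerKolyvagin, Def. 1.2.1 (arXiv Def. 2.2.1, p. 6, L63–66)] -/
theorem natCast_residueChar_add_one_smul_eq_zero (h : IsQuotientBy ρ I ρI π)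
    {v : HeightOneSpectrum (𝓞 K)} (hle : frobIdeal (R := R) ρ v ≤ I) (x : N) :
    ((residueChar v + 1 : ℕ) : R) • x = 0 :=
  h.smul_eq_zero_of_mem (hle (natCast_residueChar_add_one_mem_frobIdeal ρ v)) x

/-- The same as an integer multiple: `(ℓ+1) • x = 0` on `T/IT` for `I_ℓ ≤ I`.
[cite: Howard2004HeegnerKolyvagin, Def. 1.2.1 (arXiv Def. 2.2.1, p. 6, L63–66)] -/
theorem residueChar_add_one_nsmul_eq_zero (h : IsQuotientBy ρ I ρI π)
    {v : HeightOneSpectrum (𝓞 K)} (hle : frobIdeal (R := R) ρ v ≤ I) (x : N) :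
    (residueChar v + 1) • x = 0 := by
  rw [← Nat.cast_smul_eq_nsmul R]
  exact h.natCast_residueChar_add_one_smul_eq_zero hle x

/-- Hence **`(ℓ² - 1) • x = 0`** on `T/IT` for `I_ℓ ≤ I`; at a degree-two prime `λ`,
`ℓ² - 1 = |k_λ^×|`, which is the hypothesis «`|k_v^×|·T = 0`» of Prop. 1.1.7 / Def. 1.1.8 for the
module `T/IT` at `v = λ`.
[cite: Howard2004HeegnerKolyvagin, Prop. 1.1.7 and Def. 1.2.1 (arXiv p. 5 L129–131, p. 6 L63–66)] -/
theorem residueChar_sq_sub_one_nsmul_eq_zero (h : IsQuotientBy ρ I ρI π)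
    {v : HeightOneSpectrum (𝓞 K)} (hle : frobIdeal (R := R) ρ v ≤ I) (x : N) :
    (residueChar v ^ 2 - 1) • x = 0 := by
  have hfac : residueChar v ^ 2 - 1 = (residueChar v - 1) * (residueChar v + 1) := by
    rw [mul_comm, ← Nat.sq_sub_sq, one_pow]
  rw [hfac, mul_smul, h.residueChar_add_one_nsmul_eq_zero hle x, smul_zero]

/-- **Def. 1.2.1, the easy direction, ALWAYS**: if `ℓ+1 ∈ I` and every arithmetic Frobenius at `λ`
acts trivially on the presentation `N` of `T/IT`, then `I_ℓ ≤ I` («`I_ℓ` is the smallest ideal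
containing `ℓ+1` for which `Frob_λ` acts trivially on `T/I_ℓT`»).
[cite: Howard2004HeegnerKolyvagin, Def. 1.2.1 (arXiv Def. 2.2.1, p. 6, L63–66)] -/
theorem frobIdeal_le_of_apply_eq_self (h : IsQuotientBy ρ I ρI π) {v : HeightOneSpectrum (𝓞 K)}
    (h₁ : ((residueChar v + 1 : ℕ) : R) ∈ I)
    (h₂ : ∀ σ : absoluteGaloisGroup K, IsArithFrobAtPlace K v σ → ∀ x : N, ρI σ x = x) :
    frobIdeal (R := R) ρ v ≤ I :=
  frobIdeal_le_of_mem ρ v ⟨h₁, fun σ hσ m => h.sub_mem_of_apply_eq_self (h₂ σ hσ) m⟩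

/-- **`Frob_λ` acts trivially on `T/IT` when `I_ℓ ≤ I`**, given the defining property of `I_ℓ`
(`frobIdeal_mem_of_free` / `_of_h0` / `_of_isDiscreteValuationRing` supply it).
[cite: Howard2004HeegnerKolyvagin, Def. 1.2.1 (arXiv Def. 2.2.1, p. 6, L63–66)] -/
theorem apply_eq_self_of_isArithFrobAtPlace_of_mem (h : IsQuotientBy ρ I ρI π)
    {v : HeightOneSpectrum (𝓞 K)}
    (hmem : ((residueChar v + 1 : ℕ) : R) ∈ frobIdeal (R := R) ρ v ∧
      ∀ σ : absoluteGaloisGroup K, IsArithFrobAtPlace K v σ →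
        ∀ m : M, ρ σ m - m ∈ (frobIdeal (R := R) ρ v • (⊤ : Submodule R M) : Submodule R M))
    (hle : frobIdeal (R := R) ρ v ≤ I) {σ : absoluteGaloisGroup K} (hσ : IsArithFrobAtPlace K v σ)
    (x : N) : ρI σ x = x :=
  h.apply_eq_self_of_forall_sub_mem (fun m => Submodule.smul_mono_left hle (hmem.2 σ hσ m)) x

/-- Under the defining property of `I_ℓ`, **Def. 1.2.1 verbatim on presentations**:
`I_ℓ ≤ I ↔ (ℓ+1 ∈ I ∧ Frob_λ acts trivially on T/IT)`.
[cite: Howard2004HeegnerKolyvagin, Def. 1.2.1 (arXiv Def. 2.2.1, p. 6, L63–66)] -/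
theorem frobIdeal_le_iff_of_mem' (h : IsQuotientBy ρ I ρI π) {v : HeightOneSpectrum (𝓞 K)}
    (hmem : ((residueChar v + 1 : ℕ) : R) ∈ frobIdeal (R := R) ρ v ∧
      ∀ σ : absoluteGaloisGroup K, IsArithFrobAtPlace K v σ →
        ∀ m : M, ρ σ m - m ∈ (frobIdeal (R := R) ρ v • (⊤ : Submodule R M) : Submodule R M)) :
    frobIdeal (R := R) ρ v ≤ I ↔
      (((residueChar v + 1 : ℕ) : R) ∈ I ∧
        ∀ σ : absoluteGaloisGroup K, IsArithFrobAtPlace K v σ → ∀ x : N, ρI σ x = x) :=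
  ⟨fun hle => ⟨hle hmem.1, fun _ hσ x => h.apply_eq_self_of_isArithFrobAtPlace_of_mem hmem hle hσ x⟩,
    fun hI => h.frobIdeal_le_of_apply_eq_self hI.1 hI.2⟩

/-- **H.0 case**: for `T` free over `R`, `Frob_λ` acts trivially on `T/IT` whenever `I_ℓ ≤ I`.
[cite: Howard2004HeegnerKolyvagin, Def. 1.2.1 + H.0 (arXiv p. 6 L63–66, p. 7 L57)] -/
theorem apply_eq_self_of_isArithFrobAtPlace_of_free [Module.Free R M] (h : IsQuotientBy ρ I ρI π)
    {v : HeightOneSpectrum (𝓞 K)} (hle : frobIdeal (R := R) ρ v ≤ I) {σ : absoluteGaloisGroup K}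
    (hσ : IsArithFrobAtPlace K v σ) (x : N) : ρI σ x = x :=
  h.apply_eq_self_of_isArithFrobAtPlace_of_mem (frobIdeal_mem_of_free ρ v) hle hσ x

/-- **H.0 by name** (`H0 R M`, the head of `SatisfiesH.h0`): `Frob_λ` acts trivially on `T/IT`
whenever `I_ℓ ≤ I`. [cite: Howard2004HeegnerKolyvagin, Def. 1.2.1 + H.0 (arXiv p. 6 L63–66, p. 7 L57)] -/
theorem apply_eq_self_of_isArithFrobAtPlace_of_h0 (h0 : H0 R M) (h : IsQuotientBy ρ I ρI π)
    {v : HeightOneSpectrum (𝓞 K)} (hle : frobIdeal (R := R) ρ v ≤ I) {σ : absoluteGaloisGroup K}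
    (hσ : IsArithFrobAtPlace K v σ) (x : N) : ρI σ x = x :=
  h.apply_eq_self_of_isArithFrobAtPlace_of_mem (frobIdeal_mem_of_h0 h0 ρ v) hle hσ x

/-- **DVR case, any `T`** (`ℓ+1 ≠ 0` in `R`): `Frob_λ` acts trivially on `T/IT` whenever
`I_ℓ ≤ I`. [cite: Howard2004HeegnerKolyvagin, Def. 1.2.1 (arXiv Def. 2.2.1, p. 6, L63–66)] -/
theorem apply_eq_self_of_isArithFrobAtPlace_of_isDiscreteValuationRing [IsDomain R]
    [IsDiscreteValuationRing R] (h : IsQuotientBy ρ I ρI π) {v : HeightOneSpectrum (𝓞 K)}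
    (hℓ : ((residueChar v + 1 : ℕ) : R) ≠ 0) (hle : frobIdeal (R := R) ρ v ≤ I)
    {σ : absoluteGaloisGroup K} (hσ : IsArithFrobAtPlace K v σ) (x : N) : ρI σ x = x :=
  h.apply_eq_self_of_isArithFrobAtPlace_of_mem (frobIdeal_mem_of_isDiscreteValuationRing ρ v hℓ)
    hle hσ x

/-- H.0 case of Def. 1.2.1 verbatim: `I_ℓ ≤ I ↔ (ℓ+1 ∈ I ∧ Frob_λ acts trivially on T/IT)` for
`T` free over `R`. [cite: Howard2004HeegnerKolyvagin, Def. 1.2.1 + H.0 (arXiv p. 6 L63–66, p. 7 L57)] -/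
theorem frobIdeal_le_iff_of_free [Module.Free R M] (h : IsQuotientBy ρ I ρI π)
    (v : HeightOneSpectrum (𝓞 K)) :
    frobIdeal (R := R) ρ v ≤ I ↔
      (((residueChar v + 1 : ℕ) : R) ∈ I ∧
        ∀ σ : absoluteGaloisGroup K, IsArithFrobAtPlace K v σ → ∀ x : N, ρI σ x = x) :=
  h.frobIdeal_le_iff_of_mem' (frobIdeal_mem_of_free ρ v)

end IsQuotientBy

end Quot

/-! ## 3. At the Kolyvagin levels `T/I_nT` (`LevelData`), for `ℓ ∣ n` -/

section Levels

variable {K : Type} [Field K] [NumberField K] {M : Type} [AddCommGroup M] [TopologicalSpace M]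
  [DiscreteTopology M] {R : Type} [CommRing R] [Module R M]

namespace LevelData

variable {p : ℕ} {ρ : DiscreteGaloisModule K M} {t : SelmerTriple p ρ}
  {N : Finset (HeightOneSpectrum (𝓞 K)) → Type} [∀ n, AddCommGroup (N n)]
  [∀ n, TopologicalSpace (N n)] [∀ n, DiscreteTopology (N n)] [∀ n, Module R (N n)]

/-- `I_n` kills `T/I_nT`. [cite: Howard2004HeegnerKolyvagin, Def. 1.2.1 and Def. 1.2.3 (arXiv p. 6 L73–75, p. 7 L1–6)] -/
theorem smul_eq_zero_of_mem_levelIdeal (D : LevelData R ρ t N)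
    {n : Finset (HeightOneSpectrum (𝓞 K))} {r : R} (hr : r ∈ levelIdeal (R := R) ρ n) (x : N n) :
    r • x = 0 :=
  (D.isQuotientBy n).smul_eq_zero_of_mem hr x

/-- **`(ℓ+1)·(T/I_nT) = 0` for `ℓ ∣ n`** (no hypothesis on `R`, `T`).
[cite: Howard2004HeegnerKolyvagin, Def. 1.2.1 (arXiv Def. 2.2.1, p. 6, L63–66 and L73–75)] -/
theorem natCast_residueChar_add_one_smul_eq_zero (D : LevelData R ρ t N)
    {n : Finset (HeightOneSpectrum (𝓞 K))} {v : HeightOneSpectrum (𝓞 K)} (hv : v ∈ n)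
    (x : N n) : ((residueChar v + 1 : ℕ) : R) • x = 0 :=
  (D.isQuotientBy n).natCast_residueChar_add_one_smul_eq_zero (frobIdeal_le_levelIdeal ρ hv) x

/-- `(ℓ+1) • x = 0` on `T/I_nT` for `ℓ ∣ n`, as an integer multiple.
[cite: Howard2004HeegnerKolyvagin, Def. 1.2.1 (arXiv Def. 2.2.1, p. 6, L63–66 and L73–75)] -/
theorem residueChar_add_one_nsmul_eq_zero (D : LevelData R ρ t N)
    {n : Finset (HeightOneSpectrum (𝓞 K))} {v : HeightOneSpectrum (𝓞 K)} (hv : v ∈ n)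
    (x : N n) : (residueChar v + 1) • x = 0 :=
  (D.isQuotientBy n).residueChar_add_one_nsmul_eq_zero (frobIdeal_le_levelIdeal ρ hv) x

/-- `(ℓ² - 1) • x = 0` on `T/I_nT` for `ℓ ∣ n` (`= |k_λ^×|·x` at a degree-two `λ`: the hypothesis
«`|k_v^×|·T = 0`» of Prop. 1.1.7 for `T/I_nT` at `λ`).
[cite: Howard2004HeegnerKolyvagin, Prop. 1.1.7 and Def. 1.2.1 (arXiv p. 5 L129–131, p. 6 L63–75)] -/
theorem residueChar_sq_sub_one_nsmul_eq_zero (D : LevelData R ρ t N)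
    {n : Finset (HeightOneSpectrum (𝓞 K))} {v : HeightOneSpectrum (𝓞 K)} (hv : v ∈ n)
    (x : N n) : (residueChar v ^ 2 - 1) • x = 0 :=
  (D.isQuotientBy n).residueChar_sq_sub_one_nsmul_eq_zero (frobIdeal_le_levelIdeal ρ hv) x

/-- **`Frob_λ` acts trivially on `T/I_nT` for `ℓ ∣ n`, `T` free over `R`** (H.0) — the hypothesis
«`G_{K_v}` acts trivially» of Prop. 1.1.7 at `v = λ`, Frobenius part (inertia: `isUnramifiedAt`).
[cite: Howard2004HeegnerKolyvagin, Def. 1.2.1 + H.0 (arXiv p. 6 L63–75, p. 7 L57)] -/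
theorem ρq_apply_eq_self_of_free [Module.Free R M] (D : LevelData R ρ t N)
    {n : Finset (HeightOneSpectrum (𝓞 K))} {v : HeightOneSpectrum (𝓞 K)} (hv : v ∈ n)
    {σ : absoluteGaloisGroup K} (hσ : IsArithFrobAtPlace K v σ) (x : N n) : D.ρq n σ x = x :=
  (D.isQuotientBy n).apply_eq_self_of_isArithFrobAtPlace_of_free (frobIdeal_le_levelIdeal ρ hv) hσ x

/-- The same under the tree's `H0 R M` (the head of `SatisfiesH.h0`).
[cite: Howard2004HeegnerKolyvagin, Def. 1.2.1 + H.0 (arXiv p. 6 L63–75, p. 7 L57)] -/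
theorem ρq_apply_eq_self_of_h0 (h0 : H0 R M) (D : LevelData R ρ t N)
    {n : Finset (HeightOneSpectrum (𝓞 K))} {v : HeightOneSpectrum (𝓞 K)} (hv : v ∈ n)
    {σ : absoluteGaloisGroup K} (hσ : IsArithFrobAtPlace K v σ) (x : N n) : D.ρq n σ x = x :=
  (D.isQuotientBy n).apply_eq_self_of_isArithFrobAtPlace_of_h0 h0 (frobIdeal_le_levelIdeal ρ hv) hσ x

/-- The same for `R` a DVR with `ℓ+1 ≠ 0`, any `T`.
[cite: Howard2004HeegnerKolyvagin, Def. 1.2.1 (arXiv Def. 2.2.1, p. 6, L63–75)] -/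
theorem ρq_apply_eq_self_of_isDiscreteValuationRing [IsDomain R] [IsDiscreteValuationRing R]
    (D : LevelData R ρ t N) {n : Finset (HeightOneSpectrum (𝓞 K))} {v : HeightOneSpectrum (𝓞 K)}
    (hv : v ∈ n) (hℓ : ((residueChar v + 1 : ℕ) : R) ≠ 0) {σ : absoluteGaloisGroup K}
    (hσ : IsArithFrobAtPlace K v σ) (x : N n) : D.ρq n σ x = x :=
  (D.isQuotientBy n).apply_eq_self_of_isArithFrobAtPlace_of_isDiscreteValuationRing hℓ
    (frobIdeal_le_levelIdeal ρ hv) hσ x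

/-- `T/I_nT` is unramified wherever `T` is. [cite: Howard2004HeegnerKolyvagin, §1.2 (arXiv p. 6, L54–56)] -/
theorem isUnramifiedAt (D : LevelData R ρ t N) (n : Finset (HeightOneSpectrum (𝓞 K)))
    {v : HeightOneSpectrum (𝓞 K)} (hur : GaloisRep.IsUnramifiedAt v ρ) :
    GaloisRep.IsUnramifiedAt v (D.ρq n) :=
  (D.isQuotientBy n).isUnramifiedAt hur

/-- **`T/I_nT` is unramified at every `λ ∈ 𝓛`** (`𝓛 ⊆ 𝓛₀(T)`): the inertia part of «`G_{K_λ}`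
acts trivially on `T/I_nT`». [cite: Howard2004HeegnerKolyvagin, §1.2 (arXiv p. 6, L54–56 and L96–98)] -/
theorem isUnramifiedAt_of_mem_primes (D : LevelData R ρ t N)
    (n : Finset (HeightOneSpectrum (𝓞 K))) {v : HeightOneSpectrum (𝓞 K)} (hv : v ∈ t.primes) :
    GaloisRep.IsUnramifiedAt v (D.ρq n) :=
  D.isUnramifiedAt n (t.primes_subset hv).2.2

/-- `𝓛₀(T) ⊆ 𝓛₀(T/I_nT)`. [cite: Howard2004HeegnerKolyvagin, §1.2 (arXiv p. 6, L54–56)] -/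
theorem degreeTwoPrimes_subset (D : LevelData R ρ t N) (n : Finset (HeightOneSpectrum (𝓞 K))) :
    degreeTwoPrimes p ρ ⊆ degreeTwoPrimes p (D.ρq n) :=
  (D.isQuotientBy n).degreeTwoPrimes_subset_degreeTwoPrimes p

/-- `R`-linearity of the action passes to the levels `T/I_nT`.
[cite: Howard2004HeegnerKolyvagin, §1 conventions and Def. 1.1.3 (arXiv p. 5, L3–24 and L93–99)] -/
theorem isScalarLinear (D : LevelData R ρ t N) (hlin : ρ.IsScalarLinear R)
    (n : Finset (HeightOneSpectrum (𝓞 K))) : (D.ρq n).IsScalarLinear R :=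
  (D.isQuotientBy n).isScalarLinear hlin

end LevelData

end Levels

/-! ## 4. The compact-`T` prime sets `𝓛_s(T)` of `DVRKolyvaginBound.lean` against the typed ones -/

section TowerPrimes

variable {K : Type} [Field K] [NumberField K] {R : Type} [CommRing R] [IsLocalRing R]
  {N : ℕ → Type} [∀ k, AddCommGroup (N k)] [∀ k, TopologicalSpace (N k)]
  [∀ k, DiscreteTopology (N k)] [∀ k, Module R (N k)]

namespace AdicTower

/-- `𝓛_{s'}(T) ⊆ 𝓛_s(T)` for `s ≤ s'` (`p^{s'}R ≤ p^sR`).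
[cite: Howard2004HeegnerKolyvagin, Def. 1.2.1 (arXiv Def. 2.2.1, p. 6, L67–68)] -/
theorem kolyvaginPrimes_antitone (p : ℕ) (T : AdicTower K R N) :
    Antitone (T.kolyvaginPrimes p) := by
  intro s s' hss' v hv
  have hle : Ideal.span {((p : ℕ) : R) ^ s'} ≤ Ideal.span {((p : ℕ) : R) ^ s} :=
    Ideal.span_singleton_le_span_singleton.mpr (pow_dvd_pow _ hss')
  exact ⟨hv.1, hle hv.2.1, fun k σ hσ x => Submodule.smul_mono_left hle (hv.2.2 k σ hσ x)⟩

/-- **`𝓛_s(T) ⊆ 𝓛_s(T^{(k)})` at every level**, the right-hand side being the TYPED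
`kolyvaginPrimes (R := R) p (T.ρ k) s` (`I_ℓ(T^{(k)}) ≤ p^sR`): the unpacked condition always
implies the typed one (`mem_kolyvaginPrimes_of_forall`).
[cite: Howard2004HeegnerKolyvagin, Def. 1.2.1 (arXiv Def. 2.2.1, p. 6, L63–68)] -/
theorem mem_kolyvaginPrimes_level {p : ℕ} {T : AdicTower K R N} {s : ℕ}
    {v : HeightOneSpectrum (𝓞 K)} (hv : v ∈ T.kolyvaginPrimes p s) (k : ℕ) :
    v ∈ Howard2004.kolyvaginPrimes (R := R) p (T.ρ k) s :=
  mem_kolyvaginPrimes_of_forall p (T.ρ k) s (Set.mem_iInter.mp hv.1 k) hv.2.1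
    (fun σ hσ x => hv.2.2 k σ hσ x)

end AdicTower

end TowerPrimes

section TowerPrimesDVR

variable {K : Type} [Field K] [NumberField K] {R : Type} [CommRing R] [IsDomain R]
  [IsDiscreteValuationRing R]
  {N : ℕ → Type} [∀ k, AddCommGroup (N k)] [∀ k, TopologicalSpace (N k)]
  [∀ k, DiscreteTopology (N k)] [∀ k, Module R (N k)]

namespace AdicTower

/-- For `R` a DVR with `ℓ+1 ≠ 0` (where `I_ℓ` has its defining property on every level,
`frobIdeal_mem_of_isDiscreteValuationRing`): **`v ∈ 𝓛_s(T) ↔ v ∈ 𝓛_s(T^{(k)})` for every `k`**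
(typed right-hand sides). [cite: Howard2004HeegnerKolyvagin, Def. 1.2.1 (arXiv Def. 2.2.1, p. 6, L63–68)] -/
theorem mem_kolyvaginPrimes_iff {p : ℕ}
    (T : AdicTower K R N) (s : ℕ) {v : HeightOneSpectrum (𝓞 K)}
    (hℓ : ((residueChar v + 1 : ℕ) : R) ≠ 0) :
    v ∈ T.kolyvaginPrimes p s ↔ ∀ k, v ∈ Howard2004.kolyvaginPrimes (R := R) p (T.ρ k) s := by
  refine ⟨fun hv k => mem_kolyvaginPrimes_level hv k, fun hv => ?_⟩
  have hk := fun k =>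
    (mem_kolyvaginPrimes_iff_of_isDiscreteValuationRing p (T.ρ k) s v hℓ).mp (hv k)
  exact ⟨Set.mem_iInter.mpr fun k => (hk k).1, (hk 0).2.1, fun k σ hσ x => (hk k).2.2 σ hσ x⟩

end AdicTower

end TowerPrimesDVR

end Literature.NumberTheory.GaloisCohomology.Howard2004
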